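import Literature.Analysis.FluidPDE.GIPGlobalStability
import Literature.Analysis.FluidPDE.KatoLocalL3Exists
import Literature.Analysis.FluidPDE.KatoMaximalTime
import Literature.Analysis.FluidPDE.LocalLerayWeakStrongViscosity
import HarnessLib

/-!
# Towards the `L³` stability theorem of Gallagher–Iftimie–Planchon (2003): small-data layer

Analysis/FluidPDE proof file (theorems only, no definitions, no named facts) on the discharge
path of the named fact `Literature.Analysis.FluidPDE.GIP2003_L3_stability`
(`GIPGlobalStability.lean`; I. Gallagher, D. Iftimie, F. Planchon, *Asymptotics and stability for
global solutions to the Navier–Stokes equations*, Ann. Inst. Fourier 53 (2003) 1387–1424,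
Thm. 0.1 p. 1389, proved there as the `L³` case of Thm. 2.1 (decay, pp. 1395–1398) and
Thm. 3.1/3.2 (stability, pp. 1398–1402)).

The printed proofs rest on the small-data theory with its *quantitative* bounds (GIP, Thm. A.1
and Prop. A.2: "by the small data theory we know that there is a unique solution `w` … with
`‖w‖ ≤ 2‖w₀‖`", p. 1396; and the Lipschitz estimate of the flow, Thm. 3.1 (9)–(10)), which in
`L³(ℝ³)` is Kato's theorem (Kato 1984, Thms. 1–2; Lemarié-Rieusset 2016, Thm. 7.5). The tree
proves Kato's theorem through the physical-space Picard iteration on the Oseen kernel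
(`exists_kato_fixedPoint`, `KatoPicard.lean`) but exports only qualitative bounds
(`kato_local_L3`). This file extracts the quantitative layer needed by GIP's argument, at unit
viscosity (GIP write (1) with `ν = 1`, p. 1387):

* `GIP2003.exists_eLpNorm_three_fixedPoint_le` — `‖u(t)‖₃ ≤ ‖u₀‖₃ + c₃ K²` for a Kato fixed point
  in the class `‖u(t)‖₆ ≤ K t^{-1/4}` (Lemarié-Rieusset 2016, proof of Thm. 7.5, PDF p. 157);
* `GIP2003.exists_fixedPoint_diff_bounds` — **Lipschitz dependence on the datum** of Kato fixed
  points on a common window: if `u`, `v` are fixed points from `u₀`, `v₀` in the class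
  `(a, b)` with `A a ≤ 1`, and `‖e^{tΔ}(u₀ - v₀)‖₆ ≤ γ t^{-1/4}`, then
  `‖(u - v)(t)‖₆ ≤ 2γ t^{-1/4}` and `‖(u - v)(t)‖₃ ≤ ‖u₀ - v₀‖₃ + A a γ` (the contraction estimate of
  Kato 1984, §2, read for two data; GIP 2003, Thm. 3.1, (11) with (15)–(16) on one window);
* `GIP2003.small_data_global` — **GIP 2003, Thm. 0.1 for the zero solution** (= Kato 1984,
  Thm. 2, with the Lipschitz bound of GIP Thm. 3.2 (10) at `u ≡ 0`): there are `ε₀ > 0` and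
  `C ≥ 1` such that every weakly divergence-free `u₀ ∈ L³` with `‖u₀‖₃ ≤ ε₀` has a global Kato
  solution (`HasGlobalKatoSolution 1 u₀`), and any two global Kato solutions `U`, `V` from such
  data `u₀`, `v₀` satisfy `‖U(t) - V(t)‖₃ ≤ C ‖u₀ - v₀‖₃` for all `t ≥ 0`.

Everything is proved; nothing is restated; no statement of the tree is changed.

## References

* I. Gallagher, D. Iftimie, F. Planchon, Ann. Inst. Fourier 53 (2003) 1387–1424,
  doi:10.5802/aif.1983: Thm. 0.1 (p. 1389), proof of Thm. 2.1 (pp. 1395–1398), Thm. 3.1–3.2 and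
  proof (pp. 1398–1402), Thm. A.1, Prop. A.2. [GallagherIftimiePlanchon2003]
* T. Kato, Math. Z. 187 (1984) 471–480, Thms. 1–2, §2. [Kato1984]
* P. G. Lemarié-Rieusset, *The Navier–Stokes Problem in the 21st Century*, CRC Press 2016,
  Thm. 7.5 and its proof (PDF pp. 155–158). [LemarieRieusset2016]
-/

noncomputable section

open MeasureTheory TopologicalSpace Set Function Filter Metric
open _root_.Topology
open scoped ENNReal NNReal

namespace Literature.Analysis.FluidPDE

namespace GIP2003

/-! ### Weighted bookkeeping -/

/-- From `X ≤ M t^{-1/4}` to the weighted form `t^{1/4} X ≤ M` (`t > 0`, `M ≥ 0`). [folklore] -/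
theorem ofReal_rpow_mul_le_of_le {X : ℝ≥0∞} {t M : ℝ} (ht : 0 < t)
    (h : X ≤ ENNReal.ofReal (M * t ^ (-(1 / 4 : ℝ)))) :
    ENNReal.ofReal (t ^ (1 / 4 : ℝ)) * X ≤ ENNReal.ofReal M := by
  calc ENNReal.ofReal (t ^ (1 / 4 : ℝ)) * X
      ≤ ENNReal.ofReal (t ^ (1 / 4 : ℝ)) * ENNReal.ofReal (M * t ^ (-(1 / 4 : ℝ))) := by gcongr
    _ = ENNReal.ofReal M := by
        rw [← ENNReal.ofReal_mul (Real.rpow_nonneg ht.le _)]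
        congr 1
        rw [mul_left_comm, Real.rpow_neg ht.le, mul_inv_cancel₀ (Real.rpow_pos_of_pos ht _).ne',
          mul_one]

/-- Jointly measurable fields have jointly measurable differences. [folklore] -/
theorem measurable_uncurry_sub {u v : ℝ → (EuclideanSpace ℝ (Fin 3)) → (EuclideanSpace ℝ (Fin 3))} (hum : Measurable (uncurry u))
    (hvm : Measurable (uncurry v)) : Measurable (uncurry (u - v)) := by
  have h : uncurry (u - v) = uncurry u - uncurry v := by
    funext p; rfl
  rw [h]
  exact hum.sub hvm

/-- Linearity of the caloric test field on `L³` data at positive times: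
`e^{tΔ}(u₀ - v₀) = e^{tΔ}u₀ - e^{tΔ}v₀`. [folklore] -/
theorem heatTest_sub_of_memLp_three {u₀ v₀ : (EuclideanSpace ℝ (Fin 3)) → (EuclideanSpace ℝ (Fin 3))} (hu₀ : MemLp u₀ 3 volume)
    (hv₀ : MemLp v₀ 3 volume) {t : ℝ} (ht : 0 < t) :
    heatTest 1 (u₀ - v₀) t = heatTest 1 u₀ t - heatTest 1 v₀ t := by
  rw [heatTest_of_pos one_pos ht, heatTest_of_pos one_pos ht, heatTest_of_pos one_pos ht]
  exact heatExtension_sub_eq_of_memLp hu₀ hv₀ (by norm_num) (by positivity)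

/-- The free term `e^{tΔ}u₀` of an `L³` datum is an `L³` slice for `t ≥ 0`. [folklore] -/
theorem memLp_heatTest_three {u₀ : (EuclideanSpace ℝ (Fin 3)) → (EuclideanSpace ℝ (Fin 3))} (hu₀ : MemLp u₀ 3 volume) {t : ℝ} (ht : 0 ≤ t) :
    MemLp (heatTest 1 u₀ t) 3 volume :=
  memLp_heatFlow_holds hu₀ (by norm_num) (by positivity : (0 : ℝ) ≤ 1 * t)

/-! ### The `L³` bound of a Kato fixed point -/

/-- **`L³` bound of a Kato fixed point** (Lemarié-Rieusset 2016, proof of Thm. 7.5, PDF p. 157;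
Kato 1984, (2.3) with `q = 3`): if `u(t) = e^{tΔ}u₀ - B(u,u)(t)` on `(0, T)` with
`‖u(t)‖₆ ≤ K t^{-1/4}`, then `‖u(t)‖₃ ≤ ‖u₀‖₃ + c₃ K²` on `(0, T)`, `c₃` absolute.
[cite: LemarieRieusset2016, Thm. 7.5 (proof, PDF p. 157)] -/
theorem exists_eLpNorm_three_fixedPoint_le :
    ∃ c₃ : ℝ, 0 ≤ c₃ ∧ ∀ {u₀ : (EuclideanSpace ℝ (Fin 3)) → (EuclideanSpace ℝ (Fin 3))}, MemLp u₀ 3 volume →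
      ∀ {u : ℝ → (EuclideanSpace ℝ (Fin 3)) → (EuclideanSpace ℝ (Fin 3))}, Measurable (uncurry u) → ∀ {T K : ℝ}, 0 ≤ K →
        (∀ t ∈ Ioo 0 T, ∀ x, u t x = heatTest 1 u₀ t x -
          ∫ τ in Ioo 0 t, ∫ y, oseenKernel (1 * (t - τ)) (x - y) (u τ y) (u τ y)) →
        (∀ t ∈ Ioo 0 T, eLpNorm (u t) 6 volume ≤ ENNReal.ofReal (K * t ^ (-(1 / 4 : ℝ)))) →
        ∀ t ∈ Ioo 0 T,
          eLpNorm (u t) 3 volume ≤ eLpNorm u₀ 3 volume + ENNReal.ofReal (c₃ * K * K) := by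
  obtain ⟨c₃, hc₃, hB3⟩ := exists_eLpNorm_three_oseenDuhamel_le (E := (EuclideanSpace ℝ (Fin 3)))
  refine ⟨c₃, hc₃, fun {u₀} hu₀ {u} hum {T K} hK hfix h6 t ht => ?_⟩
  have hueq : u t = heatTest 1 u₀ t -
      fun x => ∫ τ in Ioo 0 t, ∫ y, oseenKernel (1 * (t - τ)) (x - y) (u τ y) (u τ y) :=
    funext fun x => by rw [Pi.sub_apply]; exact hfix t ht x
  have hBm : AEStronglyMeasurable
      (fun x => ∫ τ in Ioo 0 t, ∫ y, oseenKernel (1 * (t - τ)) (x - y) (u τ y) (u τ y)) volume :=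
    ((measurable_uncurry_oseenDuhamel hum hum 1).comp
      (measurable_const.prodMk measurable_id)).aestronglyMeasurable
  have h6r : ∀ τ ∈ Ioo 0 t, eLpNorm (u τ) 6 volume ≤ ENNReal.ofReal (K * τ ^ (-(1 / 4 : ℝ))) :=
    fun τ hτ => h6 τ ⟨hτ.1, hτ.2.trans ht.2⟩
  have hBle : eLpNorm
      (fun x => ∫ τ in Ioo 0 t, ∫ y, oseenKernel (1 * (t - τ)) (x - y) (u τ y) (u τ y)) 3 volume ≤
      ENNReal.ofReal (c₃ * K * K) := by
    have h := hB3 one_pos hum hum hK hK ht.1 h6r h6r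
    simpa only [Real.one_rpow, mul_one] using h
  calc eLpNorm (u t) 3 volume
      ≤ eLpNorm (heatTest 1 u₀ t) 3 volume + eLpNorm
          (fun x => ∫ τ in Ioo 0 t, ∫ y, oseenKernel (1 * (t - τ)) (x - y) (u τ y) (u τ y))
            3 volume := by
        rw [hueq]
        exact eLpNorm_sub_le (memLp_heatTest_three hu₀ ht.1.le).1 hBm (by norm_num)
    _ ≤ eLpNorm u₀ 3 volume + ENNReal.ofReal (c₃ * K * K) :=
        add_le_add (eLpNorm_heatTest_three_le hu₀ t) hBle

/-! ### Lipschitz dependence of Kato fixed points on the datum -/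

/-- **Lipschitz dependence of Kato fixed points on the datum** (Kato 1984, §2, the contraction
estimate, read for two data; GIP 2003, Thm. 3.1, (11) and (15)–(16) on a single window). There is
an absolute `A ≥ 0` such that: if `u`, `v` are Kato fixed points on `(0, T)` from `L³` data
`u₀`, `v₀`, both in the class `‖·(t)‖₆ ≤ a t^{-1/4}`, `‖·(t,x)‖ ≤ b t^{-1/2}` with `A a ≤ 1`, and
the free evolution of the difference of the data satisfies `‖e^{tΔ}(u₀ - v₀)‖₆ ≤ γ t^{-1/4}` on
`(0, T)`, then on `(0, T)`
`‖(u - v)(t)‖₆ ≤ 2γ t^{-1/4}` and `‖(u - v)(t)‖₃ ≤ ‖u₀ - v₀‖₃ + A a γ`.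
(Bootstrap on `e* = sup t^{1/4}‖(u-v)(t)‖₆ ≤ 2a < ∞`: by Kato's difference bounds
`e* ≤ γ + 2 c a e*`.) [cite: Kato1984, §2] [cite: GallagherIftimiePlanchon2003, Thm. 3.1 (proof, (11), (15)–(16))] -/
theorem exists_fixedPoint_diff_bounds :
    ∃ A : ℝ, 0 ≤ A ∧ ∀ {u₀ v₀ : (EuclideanSpace ℝ (Fin 3)) → (EuclideanSpace ℝ (Fin 3))}, MemLp u₀ 3 volume → MemLp v₀ 3 volume →
      ∀ {u v : ℝ → (EuclideanSpace ℝ (Fin 3)) → (EuclideanSpace ℝ (Fin 3))}, Measurable (uncurry u) → Measurable (uncurry v) →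
      ∀ {T a b γ : ℝ}, 0 ≤ a → 0 ≤ b → 0 ≤ γ → A * a ≤ 1 →
        (∀ t ∈ Ioo 0 T, ∀ x, u t x = heatTest 1 u₀ t x -
          ∫ τ in Ioo 0 t, ∫ y, oseenKernel (1 * (t - τ)) (x - y) (u τ y) (u τ y)) →
        (∀ t ∈ Ioo 0 T, ∀ x, v t x = heatTest 1 v₀ t x -
          ∫ τ in Ioo 0 t, ∫ y, oseenKernel (1 * (t - τ)) (x - y) (v τ y) (v τ y)) →
        (∀ t ∈ Ioo 0 T, eLpNorm (u t) 6 volume ≤ ENNReal.ofReal (a * t ^ (-(1 / 4 : ℝ)))) →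
        (∀ t ∈ Ioo 0 T, ∀ x, ‖u t x‖ ≤ b * t ^ (-(1 / 2 : ℝ))) →
        (∀ t ∈ Ioo 0 T, eLpNorm (v t) 6 volume ≤ ENNReal.ofReal (a * t ^ (-(1 / 4 : ℝ)))) →
        (∀ t ∈ Ioo 0 T, ∀ x, ‖v t x‖ ≤ b * t ^ (-(1 / 2 : ℝ))) →
        (∀ t ∈ Ioo 0 T, eLpNorm (heatTest 1 (u₀ - v₀) t) 6 volume ≤
          ENNReal.ofReal (γ * t ^ (-(1 / 4 : ℝ)))) →
        ∀ t ∈ Ioo 0 T,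
          eLpNorm ((u - v) t) 6 volume ≤ ENNReal.ofReal (2 * γ * t ^ (-(1 / 4 : ℝ))) ∧
            eLpNorm ((u - v) t) 3 volume ≤
              eLpNorm (u₀ - v₀) 3 volume + ENNReal.ofReal (A * a * γ) := by
  have hE3 : Module.finrank ℝ (EuclideanSpace ℝ (Fin 3)) = 3 := finrank_euclideanSpace_fin
  obtain ⟨cd, hcd, HD⟩ := exists_kato_diff_bounds (E := (EuclideanSpace ℝ (Fin 3))) hE3
  obtain ⟨c₃, hc₃, hB3⟩ := exists_eLpNorm_three_oseenDuhamel_le (E := (EuclideanSpace ℝ (Fin 3)))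
  refine ⟨4 * (cd + c₃), by positivity, ?_⟩
  intro u₀ v₀ hu₀ hv₀ u v hum hvm T a b γ ha hb hγ hA hfixu hfixv h6u hiu h6v hiv hγ6
  have hdm : Measurable (uncurry (u - v)) := measurable_uncurry_sub hum hvm
  have hcd4 : 4 * cd * a ≤ 1 := by nlinarith
  -- crude Kato bounds of the difference
  have h6d : ∀ t ∈ Ioo 0 T,
      eLpNorm ((u - v) t) 6 volume ≤ ENNReal.ofReal (2 * a * t ^ (-(1 / 4 : ℝ))) := by
    intro t ht
    calc eLpNorm ((u - v) t) 6 volume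
        ≤ eLpNorm (u t) 6 volume + eLpNorm (v t) 6 volume := by
          rw [Pi.sub_apply]
          exact eLpNorm_sub_le (measurable_slice hum t).aestronglyMeasurable
            (measurable_slice hvm t).aestronglyMeasurable (by norm_num)
      _ ≤ ENNReal.ofReal (a * t ^ (-(1 / 4 : ℝ))) + ENNReal.ofReal (a * t ^ (-(1 / 4 : ℝ))) :=
          add_le_add (h6u t ht) (h6v t ht)
      _ = ENNReal.ofReal (2 * a * t ^ (-(1 / 4 : ℝ))) := by
          have h0 : 0 ≤ a * t ^ (-(1 / 4 : ℝ)) := mul_nonneg ha (Real.rpow_nonneg ht.1.le _)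
          rw [← ENNReal.ofReal_add h0 h0]
          ring_nf
  have hid : ∀ t ∈ Ioo 0 T, ∀ x, ‖(u - v) t x‖ ≤ 2 * b * t ^ (-(1 / 2 : ℝ)) := by
    intro t ht x
    rw [Pi.sub_apply, Pi.sub_apply]
    calc ‖u t x - v t x‖ ≤ ‖u t x‖ + ‖v t x‖ := norm_sub_le _ _
      _ ≤ b * t ^ (-(1 / 2 : ℝ)) + b * t ^ (-(1 / 2 : ℝ)) := add_le_add (hiu t ht x) (hiv t ht x)
      _ = 2 * b * t ^ (-(1 / 2 : ℝ)) := by ring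
  -- the weighted supremum `e*` of the difference and its finiteness
  set estar : ℝ≥0∞ := ⨆ t ∈ Ioo 0 T, ENNReal.ofReal (t ^ (1 / 4 : ℝ)) * eLpNorm ((u - v) t) 6 volume
    with hestar
  have hestar_le : estar ≤ ENNReal.ofReal (2 * a) :=
    iSup₂_le fun t ht => ofReal_rpow_mul_le_of_le ht.1 (h6d t ht)
  have hestar_ne_top : estar ≠ ∞ := ne_top_of_le_ne_top ENNReal.ofReal_ne_top hestar_le
  set e : ℝ := estar.toReal with he
  have he0 : 0 ≤ e := ENNReal.toReal_nonneg
  have hestar_eq : estar = ENNReal.ofReal e := (ENNReal.ofReal_toReal hestar_ne_top).symm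
  have hle_estar : ∀ t ∈ Ioo 0 T,
      ENNReal.ofReal (t ^ (1 / 4 : ℝ)) * eLpNorm ((u - v) t) 6 volume ≤ estar := fun t ht =>
    le_iSup₂ (f := fun t (_ : t ∈ Ioo 0 T) =>
      ENNReal.ofReal (t ^ (1 / 4 : ℝ)) * eLpNorm ((u - v) t) 6 volume) t ht
  have h6de : ∀ t ∈ Ioo 0 T,
      eLpNorm ((u - v) t) 6 volume ≤ ENNReal.ofReal (e * t ^ (-(1 / 4 : ℝ))) := by
    intro t ht
    refine le_ofReal_mul_rpow_neg_of_weighted_le ht.1 ?_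
    rw [← hestar_eq]
    exact hle_estar t ht
  -- Kato's difference bounds with the sharp constant `e`
  obtain ⟨hident, h6Δ, -⟩ := HD one_pos hum hvm (t₁ := T) ha hb ha hb he0
    (by positivity : (0 : ℝ) ≤ 2 * b) h6u hiu h6v hiv h6de hid
  -- the representation of the difference
  have hrepr : ∀ t ∈ Ioo 0 T, (u - v) t = heatTest 1 (u₀ - v₀) t - fun x =>
      (∫ τ in Ioo 0 t, ∫ y, oseenKernel (1 * (t - τ)) (x - y) (u τ y) (u τ y)) -
        ∫ τ in Ioo 0 t, ∫ y, oseenKernel (1 * (t - τ)) (x - y) (v τ y) (v τ y) := by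
    intro t ht
    funext x
    rw [Pi.sub_apply, Pi.sub_apply, Pi.sub_apply, hfixu t ht x, hfixv t ht x,
      heatTest_sub_of_memLp_three hu₀ hv₀ ht.1, Pi.sub_apply]
    abel
  -- measurability of the Duhamel terms
  have hBm : ∀ (w w' : ℝ → (EuclideanSpace ℝ (Fin 3)) → (EuclideanSpace ℝ (Fin 3))), Measurable (uncurry w) → Measurable (uncurry w') → ∀ t,
      AEStronglyMeasurable (fun x => ∫ τ in Ioo 0 t, ∫ y,
        oseenKernel (1 * (t - τ)) (x - y) (w τ y) (w' τ y)) volume :=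
    fun w w' hw hw' t => ((measurable_uncurry_oseenDuhamel hw hw' 1).comp
      (measurable_const.prodMk measurable_id)).aestronglyMeasurable
  have hΔm : ∀ t, AEStronglyMeasurable (fun x =>
      (∫ τ in Ioo 0 t, ∫ y, oseenKernel (1 * (t - τ)) (x - y) (u τ y) (u τ y)) -
        ∫ τ in Ioo 0 t, ∫ y, oseenKernel (1 * (t - τ)) (x - y) (v τ y) (v τ y)) volume :=
    fun t => (hBm u u hum hum t).sub (hBm v v hvm hvm t)
  -- the bootstrap inequality `e ≤ γ + 2 cd a e`
  have hboot : ∀ t ∈ Ioo 0 T, ENNReal.ofReal (t ^ (1 / 4 : ℝ)) * eLpNorm ((u - v) t) 6 volume ≤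
      ENNReal.ofReal (γ + 2 * cd * a * e) := by
    intro t ht
    refine ofReal_rpow_mul_le_of_le ht.1 ?_
    have h1 := h6Δ t ht
    rw [Real.one_rpow, mul_one] at h1
    calc eLpNorm ((u - v) t) 6 volume
        ≤ eLpNorm (heatTest 1 (u₀ - v₀) t) 6 volume + eLpNorm (fun x =>
            (∫ τ in Ioo 0 t, ∫ y, oseenKernel (1 * (t - τ)) (x - y) (u τ y) (u τ y)) -
              ∫ τ in Ioo 0 t, ∫ y, oseenKernel (1 * (t - τ)) (x - y) (v τ y) (v τ y)) 6 volume := by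
          rw [hrepr t ht]
          exact eLpNorm_sub_le (memLp_heatTest_three (hu₀.sub hv₀) ht.1.le).1 (hΔm t)
            (by norm_num)
      _ ≤ ENNReal.ofReal (γ * t ^ (-(1 / 4 : ℝ))) +
            ENNReal.ofReal (cd * (e * a + a * e) * t ^ (-(1 / 4 : ℝ))) :=
          add_le_add (hγ6 t ht) h1
      _ = ENNReal.ofReal ((γ + 2 * cd * a * e) * t ^ (-(1 / 4 : ℝ))) := by
          have ht4 : 0 ≤ t ^ (-(1 / 4 : ℝ)) := Real.rpow_nonneg ht.1.le _
          rw [← ENNReal.ofReal_add (mul_nonneg hγ ht4) (by positivity)]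
          ring_nf
  have he_le : e ≤ γ + 2 * cd * a * e := by
    have h1 : estar ≤ ENNReal.ofReal (γ + 2 * cd * a * e) := iSup₂_le hboot
    rw [hestar_eq] at h1
    exact (ENNReal.ofReal_le_ofReal_iff (by positivity)).1 h1
  have he2 : e ≤ 2 * γ := by nlinarith
  -- conclusion
  intro t ht
  have ht4 : 0 ≤ t ^ (-(1 / 4 : ℝ)) := Real.rpow_nonneg ht.1.le _
  refine ⟨(h6de t ht).trans (ENNReal.ofReal_le_ofReal (by nlinarith)), ?_⟩
  -- the `L³` bound
  have h6ur : ∀ τ ∈ Ioo 0 t, eLpNorm (u τ) 6 volume ≤ ENNReal.ofReal (a * τ ^ (-(1 / 4 : ℝ))) :=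
    fun τ hτ => h6u τ ⟨hτ.1, hτ.2.trans ht.2⟩
  have h6vr : ∀ τ ∈ Ioo 0 t, eLpNorm (v τ) 6 volume ≤ ENNReal.ofReal (a * τ ^ (-(1 / 4 : ℝ))) :=
    fun τ hτ => h6v τ ⟨hτ.1, hτ.2.trans ht.2⟩
  have h6dr : ∀ τ ∈ Ioo 0 t,
      eLpNorm ((u - v) τ) 6 volume ≤ ENNReal.ofReal (e * τ ^ (-(1 / 4 : ℝ))) :=
    fun τ hτ => h6de τ ⟨hτ.1, hτ.2.trans ht.2⟩
  have hB1 : eLpNorm (fun x => ∫ τ in Ioo 0 t, ∫ y,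
      oseenKernel (1 * (t - τ)) (x - y) ((u - v) τ y) (u τ y)) 3 volume ≤
      ENNReal.ofReal (c₃ * e * a) := by
    have h := hB3 one_pos hdm hum he0 ha ht.1 h6dr h6ur
    simpa only [Real.one_rpow, mul_one] using h
  have hB2 : eLpNorm (fun x => ∫ τ in Ioo 0 t, ∫ y,
      oseenKernel (1 * (t - τ)) (x - y) (v τ y) ((u - v) τ y)) 3 volume ≤
      ENNReal.ofReal (c₃ * a * e) := by
    have h := hB3 one_pos hvm hdm ha he0 ht.1 h6vr h6dr
    simpa only [Real.one_rpow, mul_one] using h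
  have hΔeq : (fun x =>
      (∫ τ in Ioo 0 t, ∫ y, oseenKernel (1 * (t - τ)) (x - y) (u τ y) (u τ y)) -
        ∫ τ in Ioo 0 t, ∫ y, oseenKernel (1 * (t - τ)) (x - y) (v τ y) (v τ y)) =
      (fun x => ∫ τ in Ioo 0 t, ∫ y, oseenKernel (1 * (t - τ)) (x - y) ((u - v) τ y) (u τ y)) +
        fun x => ∫ τ in Ioo 0 t, ∫ y, oseenKernel (1 * (t - τ)) (x - y) (v τ y) ((u - v) τ y) := by
    funext x
    rw [Pi.add_apply]
    exact hident t ht x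
  have hΔ3 : eLpNorm (fun x =>
      (∫ τ in Ioo 0 t, ∫ y, oseenKernel (1 * (t - τ)) (x - y) (u τ y) (u τ y)) -
        ∫ τ in Ioo 0 t, ∫ y, oseenKernel (1 * (t - τ)) (x - y) (v τ y) (v τ y)) 3 volume ≤
      ENNReal.ofReal (4 * (cd + c₃) * a * γ) := by
    rw [hΔeq]
    calc eLpNorm ((fun x => ∫ τ in Ioo 0 t, ∫ y,
            oseenKernel (1 * (t - τ)) (x - y) ((u - v) τ y) (u τ y)) +
          fun x => ∫ τ in Ioo 0 t, ∫ y, oseenKernel (1 * (t - τ)) (x - y) (v τ y) ((u - v) τ y))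
            3 volume
        ≤ eLpNorm (fun x => ∫ τ in Ioo 0 t, ∫ y,
              oseenKernel (1 * (t - τ)) (x - y) ((u - v) τ y) (u τ y)) 3 volume +
            eLpNorm (fun x => ∫ τ in Ioo 0 t, ∫ y,
              oseenKernel (1 * (t - τ)) (x - y) (v τ y) ((u - v) τ y)) 3 volume :=
          eLpNorm_add_le (hBm _ _ hdm hum t) (hBm _ _ hvm hdm t) (by norm_num)
      _ ≤ ENNReal.ofReal (c₃ * e * a) + ENNReal.ofReal (c₃ * a * e) := add_le_add hB1 hB2
      _ = ENNReal.ofReal (2 * c₃ * a * e) := by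
          rw [← ENNReal.ofReal_add (by positivity) (by positivity)]; ring_nf
      _ ≤ ENNReal.ofReal (4 * (cd + c₃) * a * γ) := by
          refine ENNReal.ofReal_le_ofReal ?_
          have h1 : c₃ * a * e ≤ c₃ * a * (2 * γ) := mul_le_mul_of_nonneg_left he2 (by positivity)
          nlinarith [h1, mul_nonneg (mul_nonneg hcd ha) hγ]
  calc eLpNorm ((u - v) t) 3 volume
      ≤ eLpNorm (heatTest 1 (u₀ - v₀) t) 3 volume + eLpNorm (fun x =>
          (∫ τ in Ioo 0 t, ∫ y, oseenKernel (1 * (t - τ)) (x - y) (u τ y) (u τ y)) -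
            ∫ τ in Ioo 0 t, ∫ y, oseenKernel (1 * (t - τ)) (x - y) (v τ y) (v τ y)) 3 volume := by
        rw [hrepr t ht]
        exact eLpNorm_sub_le (memLp_heatTest_three (hu₀.sub hv₀) ht.1.le).1 (hΔm t) (by norm_num)
    _ ≤ eLpNorm (u₀ - v₀) 3 volume + ENNReal.ofReal (4 * (cd + c₃) * a * γ) :=
        add_le_add (eLpNorm_heatTest_three_le (hu₀.sub hv₀) t) hΔ3

/-! ### The window package: small Kato fixed points are Kato solutions, with bounds -/

/-- **The window package** (Kato 1984, Thm. 1 and §2; Lemarié-Rieusset 2016, Thm. 7.5 and its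
proof, PDF pp. 155–158; GIP 2003, Thm. A.1 with the bound "`‖w‖ ≤ 2‖w₀‖`", p. 1396, and
Thm. 3.1 (11), (15)–(16)). There are absolute `κ > 0`, `L₃, C₆ ≥ 0` such that:
(HEAT) `t^{1/4}‖e^{tΔ}f‖₆ ≤ C₆‖f‖₃` (the critical `L³ → L⁶` smoothing);
(EXIST) for `0 < α ≤ κ`, a weakly divergence-free `u₀ ∈ L³` whose free evolution satisfies
`t^{1/4}‖e^{tΔ}u₀‖₆ ≤ α` on `(0, T)` generates a Kato fixed point `u` on `(0, T)` (from a strongly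
measurable representative `v₀` of `u₀`) in the class `‖u(t)‖₆ ≤ 2α t^{-1/4}`,
`‖u(t,x)‖ ≤ 2(α + (4π)^{-1/2}‖u₀‖₃) t^{-1/2}`, with `‖u(t)‖₃ ≤ ‖u₀‖₃ + L₃ α²`, whose modification `w`
(`= u₀` at `t = 0`, `= u` on `(0, T)`) is a Kato solution on `[0, T)` (`IsKatoSolutionOn T 1 u₀ w`);
(LIPSCHITZ) two Kato fixed points on `(0, T)` from representatives of `u₀`, `v₀ ∈ L³`, both in the
class `(2α, b)` with `0 < α ≤ κ`, satisfy `‖(u - v)(t)‖₃ ≤ 2‖u₀ - v₀‖₃` on `(0, T)`.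
[cite: Kato1984, Thm. 1 and §2] [cite: LemarieRieusset2016, Thm. 7.5 (proof, PDF pp. 155–158)] [cite: GallagherIftimiePlanchon2003, Thm. A.1 and Thm. 3.1 (proof)] -/
theorem window_package :
    ∃ κ L₃ C₆ : ℝ, 0 < κ ∧ 0 ≤ L₃ ∧ 0 ≤ C₆ ∧
      (∀ f : (EuclideanSpace ℝ (Fin 3)) → (EuclideanSpace ℝ (Fin 3)), MemLp f 3 volume → ∀ t : ℝ, 0 < t →
        ENNReal.ofReal (t ^ (1 / 4 : ℝ)) *
            eLpNorm (UnboundedOperators.heatExtension f t) 6 volume ≤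
          ENNReal.ofReal C₆ * eLpNorm f 3 volume) ∧
      (∀ {α : ℝ}, 0 < α → α ≤ κ → ∀ {u₀ : (EuclideanSpace ℝ (Fin 3)) → (EuclideanSpace ℝ (Fin 3))}, MemLp u₀ 3 volume → IsWeaklyDivFree u₀ →
        ∀ {T : ℝ}, 0 < T →
        (∀ t ∈ Ioo 0 T, ENNReal.ofReal (t ^ (1 / 4 : ℝ)) *
            eLpNorm (UnboundedOperators.heatExtension u₀ t) 6 volume ≤ ENNReal.ofReal α) →
        ∃ (v₀ : (EuclideanSpace ℝ (Fin 3)) → (EuclideanSpace ℝ (Fin 3))) (u w : ℝ → (EuclideanSpace ℝ (Fin 3)) → (EuclideanSpace ℝ (Fin 3))), StronglyMeasurable v₀ ∧ u₀ =ᵐ[volume] v₀ ∧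
          Measurable (uncurry u) ∧
          (∀ t ∈ Ioo 0 T, ∀ x, u t x = heatTest 1 v₀ t x -
            ∫ τ in Ioo 0 t, ∫ y, oseenKernel (1 * (t - τ)) (x - y) (u τ y) (u τ y)) ∧
          (∀ t ∈ Ioo 0 T, eLpNorm (u t) 6 volume ≤ ENNReal.ofReal (2 * α * t ^ (-(1 / 4 : ℝ)))) ∧
          (∀ t ∈ Ioo 0 T, ∀ x, ‖u t x‖ ≤
            2 * (α + (4 * Real.pi * 1) ^ (-(1 / 2 : ℝ)) * (eLpNorm u₀ 3 volume).toReal) *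
              t ^ (-(1 / 2 : ℝ))) ∧
          IsKatoSolutionOn T 1 u₀ w ∧ (∀ t ∈ Ioo 0 T, w t = u t) ∧
          (∀ t ∈ Ioo 0 T,
            eLpNorm (u t) 3 volume ≤ eLpNorm u₀ 3 volume + ENNReal.ofReal (L₃ * α ^ 2))) ∧
      (∀ {α : ℝ}, 0 < α → α ≤ κ → ∀ {u₀ v₀ u₀' v₀' : (EuclideanSpace ℝ (Fin 3)) → (EuclideanSpace ℝ (Fin 3))}, MemLp u₀ 3 volume →
        MemLp v₀ 3 volume → u₀ =ᵐ[volume] u₀' → v₀ =ᵐ[volume] v₀' →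
        ∀ {u v : ℝ → (EuclideanSpace ℝ (Fin 3)) → (EuclideanSpace ℝ (Fin 3))} {T b : ℝ}, Measurable (uncurry u) → Measurable (uncurry v) → 0 ≤ b →
        (∀ t ∈ Ioo 0 T, ∀ x, u t x = heatTest 1 u₀' t x -
          ∫ τ in Ioo 0 t, ∫ y, oseenKernel (1 * (t - τ)) (x - y) (u τ y) (u τ y)) →
        (∀ t ∈ Ioo 0 T, ∀ x, v t x = heatTest 1 v₀' t x -
          ∫ τ in Ioo 0 t, ∫ y, oseenKernel (1 * (t - τ)) (x - y) (v τ y) (v τ y)) →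
        (∀ t ∈ Ioo 0 T, eLpNorm (u t) 6 volume ≤ ENNReal.ofReal (2 * α * t ^ (-(1 / 4 : ℝ)))) →
        (∀ t ∈ Ioo 0 T, ∀ x, ‖u t x‖ ≤ b * t ^ (-(1 / 2 : ℝ))) →
        (∀ t ∈ Ioo 0 T, eLpNorm (v t) 6 volume ≤ ENNReal.ofReal (2 * α * t ^ (-(1 / 4 : ℝ)))) →
        (∀ t ∈ Ioo 0 T, ∀ x, ‖v t x‖ ≤ b * t ^ (-(1 / 2 : ℝ))) →
        ∀ t ∈ Ioo 0 T, eLpNorm ((u - v) t) 3 volume ≤ 2 * eLpNorm (u₀ - v₀) 3 volume) := by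
  have hE3 : Module.finrank ℝ (EuclideanSpace ℝ (Fin 3)) = 3 := finrank_euclideanSpace_fin
  obtain ⟨c, hc, hFP⟩ := exists_kato_fixedPoint (E := (EuclideanSpace ℝ (Fin 3))) hE3
  obtain ⟨A, hA, hDIFF⟩ := exists_fixedPoint_diff_bounds
  obtain ⟨c₃, hc₃, hL3⟩ := exists_eLpNorm_three_fixedPoint_le
  -- the `L³ → L⁶` smoothing constant, exponent `-1/4` in dimension three
  obtain ⟨C, hC⟩ := UnboundedOperators.eLpNorm_heatExtension_le_rpow_holds (EuclideanSpace ℝ (Fin 3)) (EuclideanSpace ℝ (Fin 3))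
    (p := 3) (q := 6) (by norm_num) (by norm_num)
  have hexp : ∀ r : ℝ, 0 < r →
      r ^ (-((Module.finrank ℝ (EuclideanSpace ℝ (Fin 3)) : ℝ) / 2) * ((1 / (3 : ℝ≥0∞)).toReal - (1 / (6 : ℝ≥0∞)).toReal)) =
        r ^ (-(1 / 4 : ℝ)) := by
    intro r _
    congr 1
    rw [finrank_euclideanSpace_fin]
    norm_num [ENNReal.toReal_div]
  set C₆ : ℝ := (C : ℝ) with hC₆
  have hC₆0 : 0 ≤ C₆ := C.coe_nonneg
  have hHEAT : ∀ f : (EuclideanSpace ℝ (Fin 3)) → (EuclideanSpace ℝ (Fin 3)), MemLp f 3 volume → ∀ t : ℝ, 0 < t →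
      ENNReal.ofReal (t ^ (1 / 4 : ℝ)) *
          eLpNorm (UnboundedOperators.heatExtension f t) 6 volume ≤
        ENNReal.ofReal C₆ * eLpNorm f 3 volume := by
    intro f hf t ht
    have h1 := hC f hf t ht
    rw [hexp t ht] at h1
    have hCC : (C : ℝ≥0∞) = ENNReal.ofReal C₆ := by rw [hC₆, ENNReal.ofReal_coe_nnreal]
    calc ENNReal.ofReal (t ^ (1 / 4 : ℝ)) * eLpNorm (UnboundedOperators.heatExtension f t) 6 volume
        ≤ ENNReal.ofReal (t ^ (1 / 4 : ℝ)) *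
            ((C : ℝ≥0∞) * ENNReal.ofReal (t ^ (-(1 / 4 : ℝ))) * eLpNorm f 3 volume) := by gcongr
      _ = ENNReal.ofReal C₆ * eLpNorm f 3 volume := by
          rw [hCC, ← mul_assoc, ← mul_assoc, mul_comm (ENNReal.ofReal (t ^ (1 / 4 : ℝ))),
            mul_assoc (ENNReal.ofReal C₆), ← ENNReal.ofReal_mul (Real.rpow_nonneg ht.le _),
            Real.rpow_neg ht.le, mul_inv_cancel₀ (Real.rpow_pos_of_pos ht _).ne',
            ENNReal.ofReal_one, mul_one]
  -- the smallness threshold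
  set κ : ℝ := min (1 / c) (1 / (2 * A * (C₆ + 1) + 1)) with hκ
  have hκ0 : 0 < κ := lt_min (by positivity) (by positivity)
  have hκc : κ ≤ 1 / c := min_le_left _ _
  have hκA : κ ≤ 1 / (2 * A * (C₆ + 1) + 1) := min_le_right _ _
  have hsmallc : ∀ {α : ℝ}, 0 < α → α ≤ κ → c * α * (1 : ℝ) ^ (-(3 / 4 : ℝ)) ≤ 1 := by
    intro α hα hακ
    rw [Real.one_rpow, mul_one]
    calc c * α ≤ c * (1 / c) := mul_le_mul_of_nonneg_left (hακ.trans hκc) hc.le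
      _ = 1 := mul_one_div_cancel hc.ne'
  have hsmallA : ∀ {α : ℝ}, 0 < α → α ≤ κ → A * (2 * α) ≤ 1 ∧ 2 * A * α * C₆ ≤ 1 := by
    intro α hα hακ
    have h1 : α ≤ 1 / (2 * A * (C₆ + 1) + 1) := hακ.trans hκA
    have hden : 0 < 2 * A * (C₆ + 1) + 1 := by positivity
    rw [le_div_iff₀ hden] at h1
    constructor <;> nlinarith [mul_nonneg hA hC₆0, mul_nonneg hA hα.le,
      mul_nonneg (mul_nonneg hA hα.le) hC₆0]
  refine ⟨κ, 4 * c₃, C₆, hκ0, by positivity, hC₆0, hHEAT, ?_, ?_⟩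
  · -- (EXIST)
    intro α hα hακ u₀ hu₀ hdiv T hT hsmall
    have hcα := hsmallc hα hακ
    -- a strongly measurable representative of the datum
    set v₀ : (EuclideanSpace ℝ (Fin 3)) → (EuclideanSpace ℝ (Fin 3)) := hu₀.1.mk u₀ with hv₀def
    have hv₀m : StronglyMeasurable v₀ := hu₀.1.stronglyMeasurable_mk
    have hae : u₀ =ᵐ[volume] v₀ := hu₀.1.ae_eq_mk
    have hv₀ : MemLp v₀ 3 volume := hu₀.ae_eq hae
    have hnorm : eLpNorm v₀ 3 volume = eLpNorm u₀ 3 volume := eLpNorm_congr_ae hae.symm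
    have hheat : ∀ {t : ℝ}, 0 < t → heatTest 1 v₀ t = UnboundedOperators.heatExtension u₀ t := by
      intro t ht
      rw [heatTest_of_pos one_pos ht, one_mul, heatExtension_congr_ae hae]
    have hsm : ∀ t ∈ Ioo 0 T,
        eLpNorm (heatTest 1 v₀ t) 6 volume ≤ ENNReal.ofReal (α * t ^ (-(1 / 4 : ℝ))) := by
      intro t ht
      rw [hheat ht.1]
      exact le_ofReal_mul_rpow_neg_of_weighted_le ht.1 (hsmall t ht)
    -- the fixed point
    obtain ⟨u, hum, hu0, hfix, h6, hinf, h6loc⟩ := hFP one_pos hv₀m hv₀ hT hα hcα hsm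
    set L : ℝ := 2 * (α + (4 * Real.pi * 1) ^ (-(1 / 2 : ℝ)) * (eLpNorm u₀ 3 volume).toReal)
      with hL
    have hL0 : 0 ≤ L := by positivity
    have hinf' : ∀ t ∈ Ioo 0 T, ∀ x, ‖u t x‖ ≤ L * t ^ (-(1 / 2 : ℝ)) := by
      intro t ht x
      have h := hinf t ht x
      rwa [hnorm] at h
    -- localised smallness of the solution at `t → 0`
    have hsmall' : ∀ η : ℝ, 0 < η → ∃ t₁ : ℝ, 0 < t₁ ∧ ∀ t ∈ Ioo 0 t₁, t < T →
        eLpNorm (u t) 6 volume ≤ ENNReal.ofReal (η * t ^ (-(1 / 4 : ℝ))) := by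
      intro η hη
      set α₁ : ℝ := min (η / 2) α with hα₁
      have hα₁0 : 0 < α₁ := lt_min (by positivity) hα
      have hα₁c : c * α₁ * (1 : ℝ) ^ (-(3 / 4 : ℝ)) ≤ 1 :=
        hsmallc hα₁0 ((min_le_right _ _).trans hακ)
      have hvc : ContinuousInLpOn ({0} : Set ℝ) 3 (fun _ : ℝ => v₀) :=
        ⟨fun _ _ => hv₀, fun t₀ _ => by
          simp only [sub_self, eLpNorm_zero]
          exact tendsto_const_nhds⟩
      obtain ⟨T₁, hT₁, hsmT₁⟩ := exists_uniform_small_free_evolution one_pos isCompact_singleton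
        (subset_refl _) hvc hα₁0
      refine ⟨min T₁ T, lt_min hT₁ hT, fun t ht _ => ?_⟩
      have hloc : ∀ s ∈ Ioo 0 (min T₁ T),
          eLpNorm (heatTest 1 v₀ s) 6 volume ≤ ENNReal.ofReal (α₁ * s ^ (-(1 / 4 : ℝ))) := by
        intro s hs
        have h := hsmT₁ 0 (mem_singleton 0) s ⟨hs.1, hs.2.trans_le (min_le_left _ _)⟩
        rw [heatTest_of_pos one_pos hs.1]
        exact le_ofReal_mul_rpow_neg_of_weighted_le hs.1 h
      have h := h6loc (min_le_right _ _) hα₁0 hα₁c hloc t ht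
      refine h.trans (ENNReal.ofReal_le_ofReal (mul_le_mul_of_nonneg_right ?_
        (Real.rpow_nonneg ht.1.le _)))
      have : α₁ ≤ η / 2 := min_le_left _ _
      linarith
    -- `u ∈ C([0,T); L³)`
    obtain ⟨hcont, N, hN0, hu3⟩ := continuousInLpOn_three_of_kato_fixedPoint hE3 one_pos hv₀ hum
      (K := 2 * α) (L := L) (by positivity) hL0 hu0 hfix h6 hinf' hsmall'
    -- the field handed back
    set w : ℝ → (EuclideanSpace ℝ (Fin 3)) → (EuclideanSpace ℝ (Fin 3)) := fun t => if t = 0 then u₀ else (Ioo 0 T).indicator u t with hw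
    have hw0 : w 0 = u₀ := by simp only [hw, if_pos rfl]
    have hwt : ∀ t ∈ Ioo 0 T, w t = u t := fun t ht => by
      simp only [hw, if_neg ht.1.ne', Set.indicator_of_mem ht]
    have hwz : ∀ t, t ∉ Ioo 0 T → t ≠ 0 → w t = 0 := fun t ht ht0 => by
      simp only [hw, if_neg ht0, Set.indicator_of_notMem ht]
    have hslice : ∀ t, Measurable (u t) := fun t => measurable_slice hum t
    have hvm : Measurable (uncurry ((Ioo 0 T).indicator u)) :=
      measurable_uncurry_indicator_time hum measurableSet_Ioo
    have hwae : ∀ {S : Set ℝ}, MeasurableSet S → (0 : ℝ) ∉ S →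
        AEStronglyMeasurable (uncurry w)
          ((volume : Measure (ℝ × (EuclideanSpace ℝ (Fin 3)))).restrict (S ×ˢ univ)) := by
      intro S hS h0
      refine hvm.aestronglyMeasurable.congr ?_
      filter_upwards [ae_restrict_mem (hS.prod MeasurableSet.univ)] with q hq
      have hq0 : q.1 ≠ 0 := fun h => h0 (h ▸ (mem_prod.1 hq).1)
      simp only [uncurry, hw, if_neg hq0]
    have hwIoi : AEStronglyMeasurable (uncurry w)
        ((volume : Measure (ℝ × (EuclideanSpace ℝ (Fin 3)))).restrict (Ioi 0 ×ˢ univ)) :=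
      hwae measurableSet_Ioi (fun h => lt_irrefl (0 : ℝ) h)
    have hwIoo : AEStronglyMeasurable (uncurry w)
        ((volume : Measure (ℝ × (EuclideanSpace ℝ (Fin 3)))).restrict (Ioo 0 T ×ˢ univ)) :=
      hwae measurableSet_Ioo (fun h => lt_irrefl (0 : ℝ) h.1)
    have hwsl : ∀ t, AEStronglyMeasurable (w t) volume := by
      intro t
      by_cases ht0 : t = 0
      · rw [ht0, hw0]; exact hu₀.1
      by_cases ht : t ∈ Ioo 0 T
      · rw [hwt t ht]; exact (hslice t).aestronglyMeasurable
      · rw [hwz t ht ht0]; exact aestronglyMeasurable_zero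
    -- Kato's bounds for all `t > 0`
    have hwinf : ∀ t, 0 < t → eLpNorm (w t) ∞ volume ≤ ENNReal.ofReal (L * t ^ (-(1 / 2 : ℝ))) := by
      intro t ht
      by_cases htT : t < T
      · rw [hwt t ⟨ht, htT⟩]
        exact eLpNorm_top_le_ofReal_of_norm_le (hinf' t ⟨ht, htT⟩)
      · rw [hwz t (fun h => htT h.2) ht.ne', eLpNorm_zero]
        exact bot_le
    have hw3 : ∀ t, 0 < t → eLpNorm (w t) 3 volume ≤ ENNReal.ofReal N := by
      intro t ht
      by_cases htT : t < T
      · rw [hwt t ⟨ht, htT⟩]; exact hu3 t ⟨ht, htT⟩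
      · rw [hwz t (fun h => htT h.2) ht.ne', eLpNorm_zero]
        exact bot_le
    have hX : eKochTataruNorm w < ∞ :=
      KatoL3.eKochTataruNorm_lt_top_of_kato_bounds hE3 hwsl hwinf hw3
    have hw3mem : ∀ t ∈ Ioo 0 T, MemLp (w t) 3 volume := fun t ht => by
      rw [hwt t ht]; exact hcont.1 t ⟨ht.1.le, ht.2⟩
    -- the fixed-point identity in the tree's form
    have hfixae : ∀ t ∈ Ioo 0 T, w t =ᵐ[volume]
        fun x => UnboundedOperators.heatExtension u₀ t x - kochTataruBilinear w w t x := by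
      intro t ht
      refine Eventually.of_forall fun x => ?_
      rw [hwt t ht, hfix t ht x, hheat ht.1]
      congr 1
      simp only [kochTataruBilinear, one_mul]
      refine setIntegral_congr_fun measurableSet_Ioo fun s hs => ?_
      simp only [hwt s ⟨hs.1, hs.2.trans ht.2⟩]
    have hmild : IsMildNSSolutionOn (Ico 0 T) 1 0 u₀ w :=
      KatoL3.isMildNSSolutionOn_of_fixedPoint hu₀ hdiv hw0 hwIoi hX hw3mem hfixae
    -- continuity in `L³` on `[0, T)`
    have hwcont : ContinuousInLpOn (Ico 0 T) 3 w := by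
      refine hcont.congr_ae_slices fun t ht => ?_
      rcases ht.1.eq_or_lt with h | h
      · rw [← h, hw0, hu0]
        exact hae
      · rw [hwt t ⟨h, ht.2⟩]
    refine ⟨v₀, u, w, hv₀m, hae, hum, hfix, h6, hinf', ⟨hmild, hwcont, hw0, hwIoo⟩, hwt,
      fun t ht => ?_⟩
    -- the `L³` bound
    have h := hL3 hv₀ hum (T := T) (K := 2 * α) (by positivity) hfix h6 t ht
    rw [hnorm] at h
    refine h.trans (add_le_add le_rfl (ENNReal.ofReal_le_ofReal (le_of_eq ?_)))
    ring
  · -- (LIPSCHITZ)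
    intro α hα hακ u₀ v₀ u₀' v₀' hu₀ hv₀ hae_u hae_v u v T b hum hvm hb hfixu hfixv h6u hiu h6v hiv
      t ht
    obtain ⟨hA2, hAC⟩ := hsmallA hα hακ
    have hu₀' : MemLp u₀' 3 volume := hu₀.ae_eq hae_u
    have hv₀' : MemLp v₀' 3 volume := hv₀.ae_eq hae_v
    have hd : MemLp (u₀ - v₀) 3 volume := hu₀.sub hv₀
    have hae_d : u₀ - v₀ =ᵐ[volume] u₀' - v₀' := hae_u.sub hae_v
    set γ : ℝ := C₆ * (eLpNorm (u₀ - v₀) 3 volume).toReal with hγ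
    have hγ0 : 0 ≤ γ := by positivity
    have hγ6 : ∀ t ∈ Ioo 0 T, eLpNorm (heatTest 1 (u₀' - v₀') t) 6 volume ≤
        ENNReal.ofReal (γ * t ^ (-(1 / 4 : ℝ))) := by
      intro t ht
      rw [heatTest_of_pos one_pos ht.1, one_mul, ← heatExtension_congr_ae hae_d]
      refine le_ofReal_mul_rpow_neg_of_weighted_le ht.1 ?_
      calc ENNReal.ofReal (t ^ (1 / 4 : ℝ)) *
            eLpNorm (UnboundedOperators.heatExtension (u₀ - v₀) t) 6 volume
          ≤ ENNReal.ofReal C₆ * eLpNorm (u₀ - v₀) 3 volume := hHEAT _ hd t ht.1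
        _ = ENNReal.ofReal γ := by
            rw [hγ, ENNReal.ofReal_mul hC₆0, ENNReal.ofReal_toReal hd.eLpNorm_ne_top]
    obtain ⟨-, h3⟩ := hDIFF hu₀' hv₀' hum hvm (T := T) (a := 2 * α) (b := b) (γ := γ)
      (by positivity) hb hγ0 hA2 hfixu hfixv h6u hiu h6v hiv hγ6 t ht
    have hnorm : eLpNorm (u₀' - v₀') 3 volume = eLpNorm (u₀ - v₀) 3 volume :=
      eLpNorm_congr_ae hae_d.symm
    rw [hnorm] at h3
    have hkey : ENNReal.ofReal (A * (2 * α) * γ) ≤ eLpNorm (u₀ - v₀) 3 volume := by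
      calc ENNReal.ofReal (A * (2 * α) * γ)
          = ENNReal.ofReal ((2 * A * α * C₆) * (eLpNorm (u₀ - v₀) 3 volume).toReal) := by
            rw [hγ]; ring_nf
        _ ≤ ENNReal.ofReal (1 * (eLpNorm (u₀ - v₀) 3 volume).toReal) :=
            ENNReal.ofReal_le_ofReal (mul_le_mul_of_nonneg_right hAC ENNReal.toReal_nonneg)
        _ = eLpNorm (u₀ - v₀) 3 volume := by
            rw [one_mul, ENNReal.ofReal_toReal hd.eLpNorm_ne_top]
    calc eLpNorm ((u - v) t) 3 volume
        ≤ eLpNorm (u₀ - v₀) 3 volume + ENNReal.ofReal (A * (2 * α) * γ) := h3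
      _ ≤ eLpNorm (u₀ - v₀) 3 volume + eLpNorm (u₀ - v₀) 3 volume :=
          add_le_add (le_refl (eLpNorm (u₀ - v₀) 3 volume)) hkey
      _ = 2 * eLpNorm (u₀ - v₀) 3 volume := (two_mul _).symm

/-! ### GIP 2003, Thm. 0.1 for the zero solution: small data, global, Lipschitz -/

/-- A global Kato solution (the four clauses of `HasGlobalKatoSolution`) is a Kato solution on
every `[0, T)`. [folklore] -/
theorem isKatoSolutionOn_of_global {ν : ℝ} {u₀ : (EuclideanSpace ℝ (Fin 3)) → (EuclideanSpace ℝ (Fin 3))} {u : ℝ → (EuclideanSpace ℝ (Fin 3)) → (EuclideanSpace ℝ (Fin 3))}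
    (hmild : IsGlobalMildSolution ν 0 u₀ u) (hcont : ContinuousInLpOn (Ici 0) 3 u) (h0 : u 0 = u₀)
    (hmeas : AEStronglyMeasurable (uncurry u) (volume.restrict (Ioi 0 ×ˢ univ))) (T : ℝ) :
    IsKatoSolutionOn T ν u₀ u :=
  ⟨hmild.mono Ico_subset_Ici_self, hcont.mono Ico_subset_Ici_self, h0,
    hmeas.mono_measure (Measure.restrict_mono (prod_mono Ioo_subset_Ioi_self subset_rfl) le_rfl)⟩

/-- **GIP 2003, Thm. 0.1 at the zero solution: global existence for small `L³` data with the
Lipschitz bound** (Kato 1984, Thm. 2; GIP 2003, Thm. A.1 / Prop. A.2 and Thm. 3.2 (10) with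
`u ≡ 0`; unit viscosity). There is `ε₀ > 0` such that (i) every weakly divergence-free
`u₀ ∈ L³(ℝ³)` with `‖u₀‖₃ ≤ ε₀` has a global Kato solution (`HasGlobalKatoSolution 1 u₀`:
a duality-form mild solution in `C([0,∞); L³)` with `u(0) = u₀`, measurable on `(0,∞) × ℝ³`), and
(ii) any two global Kato solutions `U`, `V` from such data `u₀`, `v₀` satisfy
`‖U(t) - V(t)‖₃ ≤ 2‖u₀ - v₀‖₃` for every `t ≥ 0` (in particular `‖U(t)‖₃ ≤ 2‖u₀‖₃`, taking
`v₀ = 0`, `V = 0`). Proof: the window package on `[0, n)` for every `n` (the free evolution of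
small `L³` data is small in Kato's norm for all times by the `L³ → L⁶` smoothing), gluing by
uniqueness (`kato_unique_holds`, `hasGlobalKatoSolution_of_katoMaximalTime_eq_top`), and transfer
of the fixed-point Lipschitz bound to arbitrary Kato solutions by a.e. uniqueness of slices.
[cite: GallagherIftimiePlanchon2003, Thm. 0.1 (case u = 0), Thm. A.1, Thm. 3.2 (10)] [cite: Kato1984, Thm. 2] -/
theorem small_data_global :
    ∃ ε₀ : ℝ, 0 < ε₀ ∧
      (∀ u₀ : (EuclideanSpace ℝ (Fin 3)) → (EuclideanSpace ℝ (Fin 3)), MemLp u₀ 3 volume → IsWeaklyDivFree u₀ →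
          eLpNorm u₀ 3 volume ≤ ENNReal.ofReal ε₀ → HasGlobalKatoSolution 1 u₀) ∧
      (∀ (u₀ v₀ : (EuclideanSpace ℝ (Fin 3)) → (EuclideanSpace ℝ (Fin 3))) (U V : ℝ → (EuclideanSpace ℝ (Fin 3)) → (EuclideanSpace ℝ (Fin 3))), MemLp u₀ 3 volume → IsWeaklyDivFree u₀ →
          eLpNorm u₀ 3 volume ≤ ENNReal.ofReal ε₀ → MemLp v₀ 3 volume → IsWeaklyDivFree v₀ →
          eLpNorm v₀ 3 volume ≤ ENNReal.ofReal ε₀ →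
          (∀ T : ℝ, 0 < T → IsKatoSolutionOn T 1 u₀ U) →
          (∀ T : ℝ, 0 < T → IsKatoSolutionOn T 1 v₀ V) →
          ∀ t : ℝ, 0 ≤ t → eLpNorm (U t - V t) 3 volume ≤ 2 * eLpNorm (u₀ - v₀) 3 volume) := by
  obtain ⟨κ, L₃, C₆, hκ, hL₃, hC₆, hHEAT, hEX, hLIP⟩ := window_package
  set ε₀ : ℝ := κ / (C₆ + 1) with hε₀
  have hε₀0 : 0 < ε₀ := by positivity
  have hC₆ε₀ : C₆ * ε₀ ≤ κ := by
    rw [hε₀, mul_div_assoc']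
    rw [div_le_iff₀ (by positivity)]
    nlinarith
  -- the free evolution of small `L³` data is small in Kato's norm for all times
  have hfree : ∀ {u₀ : (EuclideanSpace ℝ (Fin 3)) → (EuclideanSpace ℝ (Fin 3))}, MemLp u₀ 3 volume → eLpNorm u₀ 3 volume ≤ ENNReal.ofReal ε₀ →
      ∀ {T : ℝ}, ∀ t ∈ Ioo 0 T, ENNReal.ofReal (t ^ (1 / 4 : ℝ)) *
        eLpNorm (UnboundedOperators.heatExtension u₀ t) 6 volume ≤ ENNReal.ofReal κ := by
    intro u₀ hu₀ hsmall T t ht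
    calc ENNReal.ofReal (t ^ (1 / 4 : ℝ)) * eLpNorm (UnboundedOperators.heatExtension u₀ t) 6 volume
        ≤ ENNReal.ofReal C₆ * eLpNorm u₀ 3 volume := hHEAT u₀ hu₀ t ht.1
      _ ≤ ENNReal.ofReal C₆ * ENNReal.ofReal ε₀ := by gcongr
      _ = ENNReal.ofReal (C₆ * ε₀) := (ENNReal.ofReal_mul hC₆).symm
      _ ≤ ENNReal.ofReal κ := ENNReal.ofReal_le_ofReal hC₆ε₀
  refine ⟨ε₀, hε₀0, fun u₀ hu₀ hdiv hsmall => ?_, ?_⟩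
  · -- (i) global existence: Kato solutions on every `[0, n + 1)`, hence `T_max = ∞`
    have hn : ∀ n : ℕ, ∃ w, IsKatoSolutionOn ((n : ℝ) + 1) 1 u₀ w := by
      intro n
      obtain ⟨-, -, w, -, -, -, -, -, -, hw, -, -⟩ := hEX hκ le_rfl hu₀ hdiv
        (T := (n : ℝ) + 1) (by positivity) (hfree hu₀ hsmall)
      exact ⟨w, hw⟩
    refine hasGlobalKatoSolution_of_katoMaximalTime_eq_top kato_unique_holds one_pos ?_
    refine ENNReal.eq_top_of_forall_nnreal_le fun r => ?_
    obtain ⟨n, hn'⟩ := exists_nat_gt (r : ℝ)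
    obtain ⟨w, hw⟩ := hn n
    calc (r : ℝ≥0∞) = ENNReal.ofReal (r : ℝ) := (ENNReal.ofReal_coe_nnreal).symm
      _ ≤ ENNReal.ofReal ((n : ℝ) + 1) := ENNReal.ofReal_le_ofReal (by linarith)
      _ ≤ katoMaximalTime 1 u₀ := hw.ofReal_le_katoMaximalTime
  · -- (ii) the Lipschitz bound, transferred from the fixed points by uniqueness
    intro u₀ v₀ U V hu₀ hdivu hsmallu hv₀ hdivv hsmallv hU hV t ht
    rcases ht.eq_or_lt with h | h
    · -- `t = 0`
      rw [← h, (hU 1 one_pos).initial, (hV 1 one_pos).initial, two_mul]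
      exact le_self_add
    · -- `t > 0`: compare with the fixed points on `(0, t + 1)`
      have hT : 0 < t + 1 := by linarith
      have htI : t ∈ Ioo 0 (t + 1) := ⟨h, by linarith⟩
      obtain ⟨u₀', u, wu, -, hae_u, hum, hfixu, h6u, hiu, hwu, hwut, -⟩ := hEX hκ le_rfl hu₀
        hdivu hT (hfree hu₀ hsmallu)
      obtain ⟨v₀', v, wv, -, hae_v, hvm, hfixv, h6v, hiv, hwv, hwvt, -⟩ := hEX hκ le_rfl hv₀
        hdivv hT (hfree hv₀ hsmallv)
      -- a common `L^∞` constant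
      set bu : ℝ := 2 * (κ + (4 * Real.pi * 1) ^ (-(1 / 2 : ℝ)) * (eLpNorm u₀ 3 volume).toReal)
        with hbu
      set bv : ℝ := 2 * (κ + (4 * Real.pi * 1) ^ (-(1 / 2 : ℝ)) * (eLpNorm v₀ 3 volume).toReal)
        with hbv
      have hbu0 : 0 ≤ bu := by positivity
      have hbv0 : 0 ≤ bv := by positivity
      have hiu' : ∀ s ∈ Ioo 0 (t + 1), ∀ x, ‖u s x‖ ≤ max bu bv * s ^ (-(1 / 2 : ℝ)) :=
        fun s hs x => (hiu s hs x).trans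
          (mul_le_mul_of_nonneg_right (le_max_left _ _) (Real.rpow_nonneg hs.1.le _))
      have hiv' : ∀ s ∈ Ioo 0 (t + 1), ∀ x, ‖v s x‖ ≤ max bu bv * s ^ (-(1 / 2 : ℝ)) :=
        fun s hs x => (hiv s hs x).trans
          (mul_le_mul_of_nonneg_right (le_max_right _ _) (Real.rpow_nonneg hs.1.le _))
      have hlip := hLIP hκ le_rfl hu₀ hv₀ hae_u hae_v hum hvm (le_max_of_le_left hbu0) hfixu hfixv
        h6u hiu' h6v hiv' t htI
      -- transfer to `U`, `V` by uniqueness of Kato solutions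
      have hUae : U t =ᵐ[volume] u t := by
        rw [← hwut t htI]
        exact (hU (t + 1) hT).ae_eq kato_unique_holds one_pos hwu ht htI.2 htI.2
      have hVae : V t =ᵐ[volume] v t := by
        rw [← hwvt t htI]
        exact (hV (t + 1) hT).ae_eq kato_unique_holds one_pos hwv ht htI.2 htI.2
      have hae : U t - V t =ᵐ[volume] (u - v) t := by
        rw [Pi.sub_apply]
        exact hUae.sub hVae
      rw [eLpNorm_congr_ae hae]
      exact hlip

/-! ### Restarting a global Kato solution: eventual smallness gives uniform tail smallness -/

/-- **The translate of a global Kato solution is a global Kato solution from the slice**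
(restart: `mild_L3_restart_holds`, Fabes–Jones–Rivière 1972 Thm. 2.1 / Lemarié-Rieusset 2016
Thm. 6.1; used in GIP 2003, proof of Thm. 2.1, p. 1398: "we conclude by the small data theory"
from the time `T₀`). [cite: GallagherIftimiePlanchon2003, Thm. 2.1 (proof, p. 1398)] -/
theorem isKatoSolutionOn_translate {u₀ : (EuclideanSpace ℝ (Fin 3)) → (EuclideanSpace ℝ (Fin 3))} {u : ℝ → (EuclideanSpace ℝ (Fin 3)) → (EuclideanSpace ℝ (Fin 3))}
    (hu : ∀ T : ℝ, 0 < T → IsKatoSolutionOn T 1 u₀ u) {t₀ : ℝ} (ht₀ : 0 ≤ t₀) (T : ℝ) :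
    IsKatoSolutionOn T 1 (u t₀) (fun t => u (t + t₀)) := by
  have hT0 : 0 ≤ max T 0 := le_max_right _ _
  have hTle : T ≤ max T 0 := le_max_left _ _
  have hpos : 0 < max T 0 + t₀ + 1 := by linarith
  have hK := hu (max T 0 + t₀ + 1) hpos
  have ht₀I : t₀ ∈ Ico 0 (max T 0 + t₀ + 1) := ⟨ht₀, by linarith⟩
  have hu₀ : MemLp u₀ 3 volume := hK.memLp_initial hpos
  refine ⟨?_, ?_, by simp only [zero_add], ?_⟩
  · exact (isMildNSSolutionOn_translate_of_restart mild_L3_restart_holds one_pos hpos hu₀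
      hK.mild hK.continuousInLpOn hK.aestronglyMeasurable ht₀I).mono
        (Ico_subset_Ico_right (by linarith))
  · exact hK.continuousInLpOn.translate_Ico ht₀ (by linarith)
  · exact (aestronglyMeasurable_uncurry_translate ht₀ hK.aestronglyMeasurable).mono_measure
      (Measure.restrict_mono (Set.prod_mono (Ioo_subset_Ioo_right (by linarith)) Subset.rfl)
        le_rfl)

/-- **Eventual smallness gives uniform tail smallness** (GIP 2003, proof of Thm. 2.1, last step,
p. 1398: "`‖u(T₀)‖ ≤ 3ε₀` … we conclude by the small data theory (Prop. A.2):
`‖u‖_{L^∞([T₀,∞), ·)} ≲ 3ε₀`"). With `ε₀` as in `small_data_global`: if a global Kato solution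
has `‖u(t₀)‖₃ ≤ ε₀` at some `t₀ ≥ 0`, then `‖u(t)‖₃ ≤ 2‖u(t₀)‖₃` for all `t ≥ t₀` (restart at
`t₀`, uniqueness, and the Lipschitz bound at the zero solution).
[cite: GallagherIftimiePlanchon2003, Thm. 2.1 (proof, p. 1398)] -/
theorem exists_tail_bound :
    ∃ ε₀ : ℝ, 0 < ε₀ ∧ ∀ {u₀ : (EuclideanSpace ℝ (Fin 3)) → (EuclideanSpace ℝ (Fin 3))} {u : ℝ → (EuclideanSpace ℝ (Fin 3)) → (EuclideanSpace ℝ (Fin 3))},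
      (∀ T : ℝ, 0 < T → IsKatoSolutionOn T 1 u₀ u) → ∀ {t₀ : ℝ}, 0 ≤ t₀ →
      eLpNorm (u t₀) 3 volume ≤ ENNReal.ofReal ε₀ →
      ∀ t : ℝ, t₀ ≤ t → eLpNorm (u t) 3 volume ≤ 2 * eLpNorm (u t₀) 3 volume := by
  obtain ⟨ε₀, hε₀, -, hLIP⟩ := small_data_global
  refine ⟨ε₀, hε₀, fun {u₀ u} hu {t₀} ht₀ hsmall t ht => ?_⟩
  have hK1 := hu (t₀ + 1) (by linarith)
  have hmem : MemLp (u t₀) 3 volume := hK1.memLp ⟨ht₀, by linarith⟩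
  have hdiv : IsWeaklyDivFree (u t₀) := hK1.mild.1 t₀ ⟨ht₀, by linarith⟩
  have hmem0 : MemLp (0 : (EuclideanSpace ℝ (Fin 3)) → (EuclideanSpace ℝ (Fin 3))) 3
      (volume : Measure (EuclideanSpace ℝ (Fin 3))) :=
    MemLp.zero' (ε := EuclideanSpace ℝ (Fin 3))
  have hdiv0 : IsWeaklyDivFree (0 : (EuclideanSpace ℝ (Fin 3)) → (EuclideanSpace ℝ (Fin 3))) :=
    fun θ _ => by simp
  have h := hLIP (u t₀) 0 (fun s => u (s + t₀)) 0 hmem hdiv hsmall hmem0 hdiv0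
    (by rw [eLpNorm_zero]; exact bot_le) (fun T _ => isKatoSolutionOn_translate hu ht₀ T)
    (fun T _ => isKatoSolutionOn_zero T 1) (t - t₀) (by linarith)
  simpa only [sub_add_cancel, Pi.zero_apply, sub_zero] using h

/-- **Decay criterion**: a global Kato solution whose `L³` norm becomes arbitrarily small at
*some* times tends to zero in `L³` (the reduction of GIP 2003, Thm. 2.1 / Thm. 0.1 (i), to
"`‖u(T₀)‖₃` small for one large `T₀`", pp. 1397–1398). [cite: GallagherIftimiePlanchon2003, Thm. 2.1 (proof, pp. 1397–1398)] -/
theorem tendsto_zero_of_forall_exists_small {u₀ : (EuclideanSpace ℝ (Fin 3)) → (EuclideanSpace ℝ (Fin 3))} {u : ℝ → (EuclideanSpace ℝ (Fin 3)) → (EuclideanSpace ℝ (Fin 3))}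
    (hu : ∀ T : ℝ, 0 < T → IsKatoSolutionOn T 1 u₀ u)
    (h : ∀ ε : ℝ, 0 < ε → ∃ t₀ : ℝ, 0 ≤ t₀ ∧ eLpNorm (u t₀) 3 volume ≤ ENNReal.ofReal ε) :
    Tendsto (fun t => eLpNorm (u t) 3 volume) atTop (𝓝 0) := by
  obtain ⟨ε₀, hε₀, htail⟩ := exists_tail_bound
  rw [ENNReal.tendsto_nhds_zero]
  intro ε hε
  -- a real `δ > 0` with `δ ≤ ε₀` and `2δ ≤ ε`
  obtain ⟨δ, hδ0, hδε₀, hδε⟩ : ∃ δ : ℝ, 0 < δ ∧ δ ≤ ε₀ ∧ ENNReal.ofReal (2 * δ) ≤ ε := by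
    rcases eq_or_ne ε ⊤ with htop | htop
    · exact ⟨ε₀, hε₀, le_rfl, htop ▸ le_top⟩
    · have hεr : 0 < ε.toReal := ENNReal.toReal_pos hε.ne' htop
      refine ⟨min ε₀ (ε.toReal / 2), lt_min hε₀ (by positivity), min_le_left _ _, ?_⟩
      calc ENNReal.ofReal (2 * min ε₀ (ε.toReal / 2))
          ≤ ENNReal.ofReal ε.toReal :=
            ENNReal.ofReal_le_ofReal (by linarith [min_le_right ε₀ (ε.toReal / 2)])
        _ = ε := ENNReal.ofReal_toReal htop
  obtain ⟨t₀, ht₀, hsmall⟩ := h δ hδ0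
  refine eventually_atTop.2 ⟨t₀, fun t ht => ?_⟩
  calc eLpNorm (u t) 3 volume
      ≤ 2 * eLpNorm (u t₀) 3 volume :=
        htail hu ht₀ (hsmall.trans (ENNReal.ofReal_le_ofReal hδε₀)) t ht
    _ ≤ 2 * ENNReal.ofReal δ := by gcongr
    _ = ENNReal.ofReal (2 * δ) := by rw [ENNReal.ofReal_mul zero_le_two, ENNReal.ofReal_ofNat]
    _ ≤ ε := hδε

end GIP2003

end Literature.Analysis.FluidPDE

end
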